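import Summits.Ventures.PercRepro.C026ProdCFComponents
import Summits.Ventures.PercRepro.C026ProdCFIsolated

/-!
# CONJECTURE MONO implies C-026's (CF) form for every marked multigraph (p5, gen 16)

mine-3's CONJECTURE MONO (INBOX 6006, 22:52Z): «deleting a non-mark neighbour of a mark never
increases the C-026 slack» — `Δ_CF(H − u) ≤ Δ_CF(H)` for every `u ∉ {a, b, c}` adjacent to `a`
(or, by the `a ↔ b` symmetry of `Δ_CF`, to `b`). mine-3 notes that MONO implies (CF) for all
marked multigraphs by induction on the vertices. Here that implication is typed:

* `supp`, `nonMarkSupp` — the vertices carrying an edge, the non-marks among them;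
* `delSide` — deleting the vertex `u` = keeping the edges not at `u` (`H − u = H.part (delSide u) true`);
* `Mono a b c` — the conjecture, quantified over every finite edge type of the universe of `E`;
* **`slackCF_nonneg_of_mono`** — MONO gives `0 ≤ Δ_CF` for every marked multigraph: strong
  induction on the number of edge-carrying non-marks; if some non-mark is adjacent to `a` or `b`,
  delete it (MONO + the induction hypothesis); otherwise every component core has `a` and `b`
  isolated, so (CF) holds on every core (`slackCF_nonneg_of_isolated`) and composes
  (`slackCF_nonneg_of_components`).
-/

universe u v

namespace PercRepro

open Finset

namespace MultiGraph

section Mono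

variable {V : Type u}

open Classical in
/-- The vertices carrying an edge. -/
noncomputable def supp {E : Type v} [Fintype E] (G : MultiGraph V E) : Finset V :=
  univ.image G.fst ∪ univ.image G.snd

open Classical in
/-- `v ∈ supp G` iff some edge is at `v`. -/
theorem mem_supp {E : Type v} [Fintype E] (G : MultiGraph V E) (v : V) :
    v ∈ G.supp ↔ ∃ e, G.EdgeAt e v := by
  unfold supp EdgeAt
  simp only [Finset.mem_union, Finset.mem_image, Finset.mem_univ, true_and]
  constructor
  · rintro (⟨e, he⟩ | ⟨e, he⟩)
    · exact ⟨e, Or.inl he⟩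
    · exact ⟨e, Or.inr he⟩
  · rintro ⟨e, he | he⟩
    · exact Or.inl ⟨e, he⟩
    · exact Or.inr ⟨e, he⟩

open Classical in
/-- The edge-carrying non-marks. -/
noncomputable def nonMarkSupp {E : Type v} [Fintype E] (G : MultiGraph V E) (a b c : V) :
    Finset V :=
  G.supp.filter fun v => v ≠ a ∧ v ≠ b ∧ v ≠ c

open Classical in
/-- Deleting the vertex `u`: the side `true` keeps the edges not at `u`. -/
noncomputable def delSide {E : Type v} (G : MultiGraph V E) (u : V) : E → Bool :=
  fun e => decide (¬ G.EdgeAt e u)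

open Classical in
/-- Deleting an edge-carrying non-mark strictly lowers the number of edge-carrying non-marks. -/
theorem card_nonMarkSupp_del_lt {E : Type v} [Fintype E] (G : MultiGraph V E) {a b c u : V}
    (hu : u ∈ G.nonMarkSupp a b c) :
    ((G.part (G.delSide u) true).nonMarkSupp a b c).card < (G.nonMarkSupp a b c).card := by
  have hsub : (G.part (G.delSide u) true).nonMarkSupp a b c ⊆ (G.nonMarkSupp a b c).erase u := by
    intro v hv
    unfold nonMarkSupp at hv ⊢
    rw [Finset.mem_filter, mem_supp] at hv
    obtain ⟨⟨e, he⟩, hva, hvb, hvc⟩ := hv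
    have he' : G.EdgeAt e.1 v := he
    refine Finset.mem_erase.mpr ⟨?_, Finset.mem_filter.mpr ⟨(mem_supp G v).mpr ⟨e.1, he'⟩, hva, hvb, hvc⟩⟩
    intro hvu
    subst hvu
    have : ¬ G.EdgeAt e.1 v := by
      have h2 := e.2
      simpa [delSide] using h2
    exact this he'
  calc ((G.part (G.delSide u) true).nonMarkSupp a b c).card
      ≤ ((G.nonMarkSupp a b c).erase u).card := Finset.card_le_card hsub
    _ < (G.nonMarkSupp a b c).card := Finset.card_erase_lt_of_mem hu

open Classical in
/-- **CONJECTURE MONO** (mine-3): deleting a non-mark `u` adjacent to `a` or `b` never increases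
`Δ_CF` — for every marked multigraph on `V` with a finite edge type of the universe `v`. -/
def Mono (a b c : V) : Prop :=
  ∀ (E : Type v) [Fintype E] (H : MultiGraph V E) (u : V), u ≠ a → u ≠ b → u ≠ c →
    (∃ e, H.EdgeAt e u ∧ (H.EdgeAt e a ∨ H.EdgeAt e b)) →
    (H.part (H.delSide u) true).slackCF a b c ≤ H.slackCF a b c

/-- An edge of colour `Sum.inl κ` has a non-mark end. -/
theorem nonMark_end_of_compColour_inl {E : Type v} {G : MultiGraph V E} {a b c : V} {e : E}
    {κ : Quotient (G.offMarksSetoid a b c)} (h : G.compColour a b c e = Sum.inl κ) :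
    G.fst e ∉ ({a, b, c} : Set V) ∨ G.snd e ∉ ({a, b, c} : Set V) := by
  classical
  unfold compColour at h
  by_cases h1 : G.fst e ∉ ({a, b, c} : Set V)
  · exact Or.inl h1
  · by_cases h2 : G.snd e ∉ ({a, b, c} : Set V)
    · exact Or.inr h2
    · rw [if_neg h1, if_neg h2] at h
      exact absurd h Sum.inr_ne_inl

open Classical in
/-- The induction: MONO gives (CF) for every marked multigraph with `m` edge-carrying non-marks. -/
theorem slackCF_nonneg_of_mono_aux {a b c : V} (hM : Mono.{u, v} a b c) (m : ℕ) :
    ∀ (E : Type v) [Fintype E] (G : MultiGraph V E), (G.nonMarkSupp a b c).card = m →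
      0 ≤ G.slackCF a b c := by
  induction m using Nat.strong_induction_on with
  | _ m ih =>
    intro E _ G hm
    by_cases hu : ∃ u, u ≠ a ∧ u ≠ b ∧ u ≠ c ∧ ∃ e, G.EdgeAt e u ∧ (G.EdgeAt e a ∨ G.EdgeAt e b)
    · -- delete `u`
      obtain ⟨u, hua, hub, huc, e, heu, hea⟩ := hu
      have hmem : u ∈ G.nonMarkSupp a b c :=
        Finset.mem_filter.mpr ⟨(mem_supp G u).mpr ⟨e, heu⟩, hua, hub, huc⟩
      have hlt := card_nonMarkSupp_del_lt G (a := a) (b := b) (c := c) hmem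
      rw [hm] at hlt
      have h1 := ih _ hlt _ (G.part (G.delSide u) true) rfl
      have h2 := hM E G u hua hub huc ⟨e, heu, hea⟩
      exact h1.trans h2
    · -- no non-mark is adjacent to `a` or `b`: every component core has `a` isolated
      push Not at hu
      refine slackCF_nonneg_of_components a b c fun κ _ => ?_
      refine slackCF_nonneg_of_isolated (Or.inl fun e' he' => ?_)
      have he'a : G.EdgeAt e'.1 a := he'
      rcases nonMark_end_of_compColour_inl e'.2 with hw | hw
      · -- the end `fst e'` is a non-mark adjacent to `a`
        simp only [Set.mem_insert_iff, Set.mem_singleton_iff, not_or] at hw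
        exact (hu (G.fst e'.1) hw.1 hw.2.1 hw.2.2 e'.1 (Or.inl rfl)).1 he'a
      · simp only [Set.mem_insert_iff, Set.mem_singleton_iff, not_or] at hw
        exact (hu (G.snd e'.1) hw.1 hw.2.1 hw.2.2 e'.1 (Or.inr rfl)).1 he'a

/-- **CONJECTURE MONO ⟹ (CF) for every marked multigraph** (mine-3, INBOX 6006): if deleting a
non-mark neighbour of `a` or `b` never increases `Δ_CF`, then `0 ≤ Δ_CF` on every marked multigraph
on `V` (with marks `a, b, c`). -/
theorem slackCF_nonneg_of_mono {a b c : V} (hM : Mono.{u, v} a b c) {E : Type v} [Fintype E]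
    (G : MultiGraph V E) : 0 ≤ G.slackCF a b c :=
  slackCF_nonneg_of_mono_aux hM _ E G rfl

open Classical in
/-- `Δ_CF` is symmetric in the marks `a`, `b`. -/
theorem slackCF_swap_ab {E : Type v} [Fintype E] (G : MultiGraph V E) (a b c : V) :
    G.slackCF a b c = G.slackCF b a c := by
  unfold slackCF
  have e1 : (univ.filter fun ω : Config E => G.Conn ω a b ∧ ¬ G.Conn ω a c) =
      univ.filter fun ω : Config E => G.Conn ω b a ∧ ¬ G.Conn ω b c := by
    refine Finset.filter_congr fun ω _ => ?_
    constructor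
    · rintro ⟨hab, hac⟩
      exact ⟨hab.symm, fun h => hac (hab.trans h)⟩
    · rintro ⟨hba, hbc⟩
      exact ⟨hba.symm, fun h => hbc (hba.trans h)⟩
  have e2 : (univ.filter fun ω : Config E => G.Conn ω a b ∧ ¬ G.Conn ωᶜ c a ∧ ¬ G.Conn ωᶜ c b) =
      univ.filter fun ω : Config E => G.Conn ω b a ∧ ¬ G.Conn ωᶜ c b ∧ ¬ G.Conn ωᶜ c a := by
    refine Finset.filter_congr fun ω _ => ?_
    constructor
    · rintro ⟨hab, hca, hcb⟩
      exact ⟨hab.symm, hcb, hca⟩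
    · rintro ⟨hba, hcb, hca⟩
      exact ⟨hba.symm, hca, hcb⟩
  rw [e1, e2]
  ring

open Classical in
/-- **CONJECTURE MONO as mine-3 states it** (INBOX 6006): for every marked multigraph and every
choice of marks, deleting a non-mark neighbour of the FIRST mark `a` never increases `Δ_CF`. -/
def MonoA (V : Type u) : Prop :=
  ∀ (E : Type v) [Fintype E] (H : MultiGraph V E) (a b c u : V), u ≠ a → u ≠ b → u ≠ c →
    (∃ e, H.EdgeAt e u ∧ H.EdgeAt e a) →
    (H.part (H.delSide u) true).slackCF a b c ≤ H.slackCF a b c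

/-- mine-3's form gives the two-sided form, by the `a ↔ b` symmetry of `Δ_CF`. -/
theorem mono_of_monoA (h : MonoA.{u, v} V) (a b c : V) : Mono.{u, v} a b c := by
  intro E _ H u hua hub huc ⟨e, heu, hea⟩
  rcases hea with hea | heb
  · exact h E H a b c u hua hub huc ⟨e, heu, hea⟩
  · have := h E H b a c u hub hua huc ⟨e, heu, heb⟩
    rw [slackCF_swap_ab _ a b c, slackCF_swap_ab H a b c]
    exact this

/-- **CONJECTURE MONO (mine-3's form) ⟹ (CF) for every marked multigraph.** -/
theorem slackCF_nonneg_of_monoA (h : MonoA.{u, v} V) {E : Type v} [Fintype E] (G : MultiGraph V E)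
    (a b c : V) : 0 ≤ G.slackCF a b c :=
  slackCF_nonneg_of_mono (mono_of_monoA h a b c) G

end Mono

end MultiGraph

end PercRepro
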